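import Literature.NumberTheory.EllipticCurves.SingularModuliClassGroupActionOrder
import Summits.BirchSwinnertonDyer.BirchSwinnertonDyer.Theorems.SylvesterTwoHeegnerIndexLevelFixingLevelFormFactorisation
import HarnessLib

/-!
# (W2-b) `stub_levelFixingSeven` — THE CLASS `η* = [(243, 243m, 61m²)] ∈ Cl(−243m²)[2]` AND THE CLASS IDENTITY
# `[fricke 243 Q_n] = [Q_n] · η*` ON THE W-CLASS `p ≡ 25 (mod 27)` AT EVERY LEVEL `n`
# (crux `UpperOffV0HSYPlus`, stmt-BirchSwinnertonDyer-19804; route `SylvesterTwoHeegnerIndex`, rung K7t)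

Cell `bsd-cm`, seat `bsd-cm-k7t-w2b` g0.  Helper toward `stmt-BirchSwinnertonDyer-19804` (`--supports … --as helper`); sequel of
k7t-c2 g32's `…LevelFixingLevelFormFactorisation.lean` (p749469: Gross's `w_N`-formula `[fricke 243 Q_n]·[𝔫ₙ] = [Q_n]` for every
admissible `(p, n)`, and `[𝔫₁]² = 1 ≠ [𝔫₁]` at `n = 1` on the W-class).  THEOREMS ONLY (no definition, no named fact, no
instance, no notation, no `sorry`).  Currency: `classOf' Δ f ∈ ClassGroup (QO Δ)` for `Δ : NegDiscr` (`OrderCl`), `BinQF.IsPosPrim`,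
`negForm`, `classOf'_mul_negForm`, `classOf'_eq_of_modEq_two_mul` (k-ty1 p749573).

CONTEXT (memo `W2B-RECIPROCITY-k7t-c2-g32.md` v2 §2 (c)/(e), §4.2, §4.4).  With `m = pn`, the class
`η* := [(243, 243m, 61m²)]` of discriminant `−243m²` is the class of the invertible `𝒪_{9m}`-ideal attached to the idèle
`(√−3)_w` — the translation by which the decomposition involution at `w` acts on the CM points of conductor `9m` (the seat's exact
numerics: `[Q′]·[Q_n]⁻¹ = η*` for the tabulated partner `Q′` in all six classes `(p mod 27, n mod 3)`, 49 rows).  This file supplies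
the class-group facts about `η*` that every route ((R1), (4.1), (4.2)) consumes, for EVERY level:

* §1 `isPosPrim_etaStar` (`3 ∤ m`), `classOf'_negForm_etaStar` (`[(243, −243m, 61m²)] = η*`: a `T`-translate, `486m ≡ 0`),
  ★ `classOf'_etaStar_mul_self` / `classOf'_etaStar_sq` — **`η*² = 1`** (ambiguous form).
* §2 (W-class, every `n`) ★ `classOf'_sylvester_levelForm_eq_etaStar` — **`[𝔫ₙ] = η*`** for `p ≡ 25 (mod 27)`: both are
  `(243, b, ·)` with `nB ≡ 243pn (mod 486)` (`nB − 243pn = −36n(p+2)(p+9)`, `27 ∣ p + 2`); hence `classOf'_sylvester_levelForm_sq`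
  (`[𝔫ₙ]² = 1`, all `n` — p749469 has `n = 1`) and ★★ `classOf'_fricke_sylvester_eq_mul_etaStar` —
  **`[fricke 243 Q_n] = [Q_n] · η*`**, THE CLASS IDENTITY (c) OF THE (W2-b) REDUCTION ON THE W-CLASS AT EVERY LEVEL `n`
  (p749469's `w_N`-formula × `[𝔫ₙ] = η*` × `η*² = 1`).  With `orbitForm_W_sylvesterTower` (p748618) this is the complete
  `(class, residue, sheet)` datum of the partner on the W-class; the A-classes' identity `[Q_n^{A^iW}] = [Q_n]·η*` is NOT here.

HONEST LABEL: no stub closed; nothing asserted on 19804; X12.CMAtTwo NOT proved; BSD is proved for no curve.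

## References
* B. H. Gross, *Heegner points on `X₀(N)`* (1984), §I.1, §5 (`w_N` on Heegner points). [Gross1984]
* D. A. Cox, *Primes of the form x² + ny²*, 2nd ed. (2013), §2.A (translates), §3.A Lemma 3.2 / Thm. 3.9 (ambiguous forms),
  §7.B Thm. 7.7. [Cox2013]
* Y. Hu, J. Shu, H. Yin, Trans. AMS 372 (2019) = arXiv:1708.05266, §2.2 (case split mod 27), §4.1. [HuShuYin2019]
-/

set_option autoImplicit false
-- the Summit-side namespace `Summit.BirchSwinnertonDyer.BirchSwinnertonDyer.…` (summit = problem) is mandated by D-0017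
set_option linter.dupNamespace false

noncomputable section

open scoped Classical

namespace Summit.BirchSwinnertonDyer.BirchSwinnertonDyer.Theorems.SylvesterTwoLevelFixingClassA

open Literature.Computability.Cryptography.Hallgren2005
open Literature.Computability.Cryptography.Hallgren2005.OrderCl
open Literature.NumberTheory.QuadraticFields.Quadratic
open Literature.NumberTheory.EllipticCurves Literature.NumberTheory.EllipticCurves.HeegnerForm
  Literature.NumberTheory.EllipticCurves.HuShuYin2019
  Summit.BirchSwinnertonDyer.BirchSwinnertonDyer.Theorems.SylvesterTwoLevelFixingClass

variable (Δ : NegDiscr)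

/-! ## §1 The ambiguous class `η* = [(243, 243m, 61m²)]` of discriminant `−243m²` -/

/-- **`(243, 243m, 61m²)` is primitive positive definite of discriminant `(9m)²·(−3) = −243m²`** for `m ≥ 1`, `3 ∤ m`
(`gcd(243, 243m, 61m²) = gcd(3⁵, 61m²) = 1`). [cite: Cox2013, §2.A] -/
theorem isPosPrim_etaStar {m : ℕ} (hm3 : ¬ 3 ∣ m) (hΔ : Δ.D = ((9 * m : ℕ) : ℤ) ^ 2 * (-3)) :
    (⟨243, 243 * (m : ℤ), 61 * (m : ℤ) ^ 2⟩ : BinQF).IsPosPrim Δ.D := by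
  refine ⟨?_, by norm_num, ?_⟩
  · rw [hΔ, BinQF.disc]; push_cast; ring
  · rw [BinQF.isPrimitive_iff]
    intro d hd₁ _ hd₃
    by_contra hd
    obtain ⟨q, hq, hqd⟩ := Int.exists_prime_and_dvd (fun h ↦ hd (Int.isUnit_iff_natAbs_eq.mpr h))
    have hq3 : q ∣ 3 := by
      have h : q ∣ (3 : ℤ) ^ 5 := by norm_num; exact hqd.trans hd₁
      exact hq.dvd_of_dvd_pow h
    have h3 : (3 : ℤ) ∣ 61 * (m : ℤ) ^ 2 := ((hq.associated_of_dvd Int.prime_three hq3).symm.dvd.trans hqd).trans hd₃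
    rcases Int.prime_three.dvd_or_dvd h3 with h | h
    · norm_num at h
    · exact hm3 (by exact_mod_cast Int.prime_three.dvd_of_dvd_pow h)

/-- `[(243, −243m, 61m²)] = [(243, 243m, 61m²)]`: the opposite form of `η*` is a translate of it (`−243m ≡ 243m (mod 486)`).
[cite: Cox2013, §2.A, §3.A (ambiguous forms)] -/
theorem classOf'_negForm_etaStar {m : ℕ} (hm3 : ¬ 3 ∣ m) (hΔ : Δ.D = ((9 * m : ℕ) : ℤ) ^ 2 * (-3)) :
    classOf' Δ (negForm ⟨243, 243 * (m : ℤ), 61 * (m : ℤ) ^ 2⟩) = classOf' Δ ⟨243, 243 * (m : ℤ), 61 * (m : ℤ) ^ 2⟩ := by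
  have h := isPosPrim_etaStar Δ hm3 hΔ
  have hn : (negForm ⟨243, 243 * (m : ℤ), 61 * (m : ℤ) ^ 2⟩ : BinQF) = ⟨243, -(243 * (m : ℤ)), 61 * (m : ℤ) ^ 2⟩ := rfl
  rw [hn] at *
  refine classOf'_eq_of_modEq_two_mul Δ (isPosPrim_negForm h) h ((Int.modEq_iff_dvd).mpr ⟨m, by ring⟩)

/-- ★ **`η* · η* = 1` in `Cl(−243m²)`** (`[f]·[f̄] = 1` and `[f̄] = [f]`). [cite: Cox2013, §3.A Lemma 3.10 / Thm. 3.9] -/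
theorem classOf'_etaStar_mul_self {m : ℕ} (hm3 : ¬ 3 ∣ m) (hΔ : Δ.D = ((9 * m : ℕ) : ℤ) ^ 2 * (-3)) :
    classOf' Δ ⟨243, 243 * (m : ℤ), 61 * (m : ℤ) ^ 2⟩ * classOf' Δ ⟨243, 243 * (m : ℤ), 61 * (m : ℤ) ^ 2⟩ = 1 := by
  have h := classOf'_mul_negForm Δ (isPosPrim_etaStar Δ hm3 hΔ)
  rwa [classOf'_negForm_etaStar Δ hm3 hΔ] at h

/-- ★ **`η*² = 1` in `Cl(−243m²)`.** [cite: Cox2013, §3.A Thm. 3.9] -/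
theorem classOf'_etaStar_sq {m : ℕ} (hm3 : ¬ 3 ∣ m) (hΔ : Δ.D = ((9 * m : ℕ) : ℤ) ^ 2 * (-3)) :
    classOf' Δ ⟨243, 243 * (m : ℤ), 61 * (m : ℤ) ^ 2⟩ ^ 2 = 1 := by
  rw [sq, classOf'_etaStar_mul_self Δ hm3 hΔ]

/-- `η*` is its own inverse. [cite: Cox2013, §3.A Thm. 3.9] -/
theorem classOf'_etaStar_inv {m : ℕ} (hm3 : ¬ 3 ∣ m) (hΔ : Δ.D = ((9 * m : ℕ) : ℤ) ^ 2 * (-3)) :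
    (classOf' Δ ⟨243, 243 * (m : ℤ), 61 * (m : ℤ) ^ 2⟩)⁻¹ = classOf' Δ ⟨243, 243 * (m : ℤ), 61 * (m : ℤ) ^ 2⟩ :=
  inv_eq_of_mul_eq_one_right (classOf'_etaStar_mul_self Δ hm3 hΔ)

/-! ## §2 The W-class `p ≡ 25 (mod 27)`, every level `n`: `[𝔫ₙ] = η*` and `[fricke 243 Q_n] = [Q_n]·η*` -/

/-- `3 ∤ n` from «every prime factor of `n` is `≡ 2 (mod 3)`» is not needed here; we take `3 ∤ n` as a binder.  The residue
congruence behind `[𝔫ₙ] = η*`: `nB − 243pn = −36n(p+2)(p+9) ≡ 0 (mod 486)` for `p ≡ 25 (mod 27)` (private helper).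
[cite: HuShuYin2019, §2.2 (case split of p mod 27)] -/
private theorem sylvester_B_modEq {p : ℕ} (hp : p % 27 = 25) (n : ℕ) :
    (n : ℤ) * (-(9 * (4 * (p : ℤ) ^ 2 + 17 * p + 72))) ≡ 243 * ((p * n : ℕ) : ℤ) [ZMOD 2 * ((243 : ℕ) : ℤ)] := by
  obtain ⟨s, rfl⟩ : ∃ s : ℕ, p = 27 * s + 25 := ⟨p / 27, by omega⟩
  refine (Int.modEq_iff_dvd).mpr ⟨(n : ℤ) * (2 * (s : ℤ) + 2) * (27 * (s : ℤ) + 34), ?_⟩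
  push_cast
  ring

/-- ★ **`[𝔫ₙ] = η*` on the W-class, every level**: for `p ≡ 25 (mod 27)`, `n ≥ 1`, `3 ∤ n`, `gcd(n, C) = 1` the level form
`𝔫ₙ = (243, nB, (n²A/243)·C)` of Hu–Shu–Yin's `Q_n` and `η* = (243, 243pn, 61(pn)²)` are `T`-translates (`nB ≡ 243pn (mod 486)`),
hence have the same class in `Cl(−243p²n²)`. [cite: Cox2013, §2.A with §7.B Thm. 7.7] [cite: HuShuYin2019, §4.1] -/
theorem classOf'_sylvester_levelForm_eq_etaStar {p n : ℕ} (hp : p % 27 = 25) (hn : n ≠ 0) (hn3 : ¬ 3 ∣ n)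
    (hnC : IsCoprime (n : ℤ) (4 * (p : ℤ) ^ 2 + 18 * p + 81)) (hΔ : Δ.D = ((9 * p * n : ℕ) : ℤ) ^ 2 * (-3)) :
    classOf' Δ ⟨((243 : ℕ) : ℤ), (n : ℤ) * (-(9 * (4 * (p : ℤ) ^ 2 + 17 * p + 72))),
        (n : ℤ) ^ 2 * (81 * ((p : ℤ) ^ 2 + 4 * p + 16)) / 243 * (4 * (p : ℤ) ^ 2 + 18 * p + 81)⟩ =
      classOf' Δ ⟨243, 243 * ((p * n : ℕ) : ℤ), 61 * ((p * n : ℕ) : ℤ) ^ 2⟩ := by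
  have hp3 : p % 3 = 1 := by omega
  have hm3 : ¬ 3 ∣ p * n := by
    intro h
    rcases (Nat.Prime.dvd_mul Nat.prime_three).mp h with h' | h'
    · omega
    · exact hn3 h'
  have hΔ' : Δ.D = ((9 * (p * n) : ℕ) : ℤ) ^ 2 * (-3) := by rw [hΔ, Nat.mul_assoc]
  have hn' := isPosPrim_sylvester_levelForm hp3 hn hn3 hnC
  rw [← hΔ] at hn'
  have he := isPosPrim_etaStar Δ hm3 hΔ'
  have he' : (⟨((243 : ℕ) : ℤ), 243 * ((p * n : ℕ) : ℤ), 61 * ((p * n : ℕ) : ℤ) ^ 2⟩ : BinQF).IsPosPrim Δ.D := by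
    simpa only [Nat.cast_ofNat] using he
  have h := classOf'_eq_of_modEq_two_mul Δ hn' he' (sylvester_B_modEq hp n)
  simpa only [Nat.cast_ofNat] using h

/-- **`[𝔫ₙ]² = 1` on the W-class, every level `n`** (p749469 `classOf'_sylvester_levelForm_sq_eq_one` is the case `n = 1`).
[cite: Cox2013, §3.A Thm. 3.9] -/
theorem classOf'_sylvester_levelForm_sq {p n : ℕ} (hp : p % 27 = 25) (hn : n ≠ 0) (hn3 : ¬ 3 ∣ n)
    (hnC : IsCoprime (n : ℤ) (4 * (p : ℤ) ^ 2 + 18 * p + 81)) (hΔ : Δ.D = ((9 * p * n : ℕ) : ℤ) ^ 2 * (-3)) :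
    classOf' Δ ⟨((243 : ℕ) : ℤ), (n : ℤ) * (-(9 * (4 * (p : ℤ) ^ 2 + 17 * p + 72))),
        (n : ℤ) ^ 2 * (81 * ((p : ℤ) ^ 2 + 4 * p + 16)) / 243 * (4 * (p : ℤ) ^ 2 + 18 * p + 81)⟩ ^ 2 = 1 := by
  have hm3 : ¬ 3 ∣ p * n := by
    intro h
    rcases (Nat.Prime.dvd_mul Nat.prime_three).mp h with h' | h'
    · omega
    · exact hn3 h'
  have hΔ' : Δ.D = ((9 * (p * n) : ℕ) : ℤ) ^ 2 * (-3) := by rw [hΔ, Nat.mul_assoc]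
  rw [classOf'_sylvester_levelForm_eq_etaStar Δ hp hn hn3 hnC hΔ, classOf'_etaStar_sq Δ hm3 hΔ']

/-- ★★ **THE CLASS IDENTITY ON THE W-CLASS, EVERY LEVEL: `[fricke 243 Q_n] = [Q_n] · η*`** for `p ≡ 25 (mod 27)`, `n ≥ 1`,
`3 ∤ n`, `gcd(n, C) = 1`, `Δ.D = (9pn)²·(−3)`: Gross's `w_N`-formula `[fricke 243 Q_n]·[𝔫ₙ] = [Q_n]` (p749469
`classOf'_fricke_sylvester`) with `[𝔫ₙ] = η*` and `η*² = 1`.  Together with `orbitForm_W_sylvesterTower` (p748618: `fricke 243 Q_n`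
is a level-`243` Heegner form with the residue of `Q_n` and CM point `w₂₄₃ • τ_n`) this is the `(class, residue, sheet)` datum the
(W2-b) reductions consume on the W-class: an automorphism of `ℂ` fixing `K` that translates the classes of discriminant `−243p²n²`
by `η*` carries `j(τ_n)` to `j(w₂₄₃ • τ_n)`. [cite: Gross1984, §5] [cite: Cox2013, §3.A, §7.B Thm. 7.7] [cite: HuShuYin2019, §2.2, §4.1] -/
theorem classOf'_fricke_sylvester_eq_mul_etaStar {p n : ℕ} (hp : p % 27 = 25) (hn : n ≠ 0) (hn3 : ¬ 3 ∣ n)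
    (hnC : IsCoprime (n : ℤ) (4 * (p : ℤ) ^ 2 + 18 * p + 81)) (hΔ : Δ.D = ((9 * p * n : ℕ) : ℤ) ^ 2 * (-3)) :
    classOf' Δ ⟨(fricke 243 ((n : ℤ) ^ 2 * (81 * ((p : ℤ) ^ 2 + 4 * p + 16)),
        (n : ℤ) * (-(9 * (4 * (p : ℤ) ^ 2 + 17 * p + 72))), 4 * (p : ℤ) ^ 2 + 18 * p + 81)).1,
      (fricke 243 ((n : ℤ) ^ 2 * (81 * ((p : ℤ) ^ 2 + 4 * p + 16)),
        (n : ℤ) * (-(9 * (4 * (p : ℤ) ^ 2 + 17 * p + 72))), 4 * (p : ℤ) ^ 2 + 18 * p + 81)).2.1,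
      (fricke 243 ((n : ℤ) ^ 2 * (81 * ((p : ℤ) ^ 2 + 4 * p + 16)),
        (n : ℤ) * (-(9 * (4 * (p : ℤ) ^ 2 + 17 * p + 72))), 4 * (p : ℤ) ^ 2 + 18 * p + 81)).2.2⟩ =
      classOf' Δ ⟨(n : ℤ) ^ 2 * (81 * ((p : ℤ) ^ 2 + 4 * p + 16)),
        (n : ℤ) * (-(9 * (4 * (p : ℤ) ^ 2 + 17 * p + 72))), 4 * (p : ℤ) ^ 2 + 18 * p + 81⟩ *
      classOf' Δ ⟨243, 243 * ((p * n : ℕ) : ℤ), 61 * ((p * n : ℕ) : ℤ) ^ 2⟩ := by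
  have hp3 : p % 3 = 1 := by omega
  have hm3 : ¬ 3 ∣ p * n := by
    intro h
    rcases (Nat.Prime.dvd_mul Nat.prime_three).mp h with h' | h'
    · omega
    · exact hn3 h'
  have hΔ' : Δ.D = ((9 * (p * n) : ℕ) : ℤ) ^ 2 * (-3) := by rw [hΔ, Nat.mul_assoc]
  have hG := classOf'_fricke_sylvester Δ hp3 hn hn3 hnC hΔ
  rw [classOf'_sylvester_levelForm_eq_etaStar Δ hp hn hn3 hnC hΔ] at hG
  rw [← hG, mul_assoc, classOf'_etaStar_mul_self Δ hm3 hΔ', mul_one]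

end Summit.BirchSwinnertonDyer.BirchSwinnertonDyer.Theorems.SylvesterTwoLevelFixingClassA

end
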